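import Literature.MathematicalPhysics.QuantumLattice.DWaveSymmetricGroundStateLRO
import Literature.MathematicalPhysics.QuantumLattice.HubbardNNNHoppingTorusLimitCorrelator
import Literature.MathematicalPhysics.QuantumLattice.HubbardTTPrimeEnergyDensityVariationalPrinciple
import Literature.MathematicalPhysics.QuantumLattice.CanonicalClassChemicalPotential
import HarnessLib

/-!
# Torus limits of the summit's sector ground states are gauge-SYMMETRIC translation-invariant ground
# states of the grand-canonical `t–t'` Hubbard pencil (for some chemical potential): zero pair amplitude,
# and — modulo uniqueness `[U]` — `d`-wave ODLRO `≥ (m*)²`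

Topic `Literature/MathematicalPhysics/QuantumLattice` (namespace = path). Seat `hubbard-cq-p4` (cell
`pub/hubbard-cq`). Assembly of tree theorems, everything PROVED; no definition, no named fact, zero compute.
It states, for the ADMISSIBLE FAMILIES of the summit statement `HubbardSuperconductivity` (normalised
ground states `ψ_L` of `hubbardTorusTT' L 1 t' U` — at `t' = 0` literally `hubbardTorus 2 L 1 U` — in the
sectors `(N_L, S^z = 0)`, `N_L = 2⌊n L²/2⌋ = rectN n L`, `n = 1 − δ ∈ (0, 2)`), what their infinite-volume
limit states ARE in the Koma–Tasaki / Bratteli–Kishimoto–Robinson vocabulary of the cell's dictionary (44):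

* `IsTorusLimitOf.exists_isMeanEnergyMinimiser_hubbardTTPrimeMu_of_sectorGroundStates` — every torus limit
  `ω` (along sides `Ls → ∞`) is, for SOME chemical potential `μ`, a translation-invariant MEAN-ENERGY
  MINIMISER (infinite-volume ground state) of `hubbardTTPrimeMuInteraction 1 t' U μ`: it has density `n`
  (`IsTorusLimitOf.density_eq_of_rectN`), mean energy `e(n) = energyDensityTT' 1 t' U n`
  (`IsTorusLimitOf.meanEnergy_hubbardTTPrime_eq_energyDensityTT'`), hence minimises among
  translation-invariant states of density `n` (`energyDensityTT'_le_meanEnergy_of_isTranslationInvariant`),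
  hence is a grand-canonical minimiser for a supporting `μ`
  (`isMeanEnergyMinimiser_pencil_number_of_canonical`, `U ≥ 0`, `0 < n < 2`).
* `IsTorusLimitOf.symmetric_groundState_of_sectorGroundStates` — and it is GAUGE INVARIANT with ZERO pair
  amplitude `ω(P_x) = 0` for every local singlet pair (`IsTorusLimitOf.isGaugeInvariant`,
  `…expect_localPairAt_eq_zero`): the limit states of the summit's own ground states sit at the CENTRE of
  the disc `{ω(P₀^d)} = closedBall 0 m*` of ground-state pair amplitudes
  (`image_expect_localPairAt_groundStates_eq_closedBall`); order, if any, lives in their two-point function.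
* **`IsTorusLimitOf.dWaveOrderParameterTT'_sq_le_re_boxAverage_of_sectorGroundStates_of_unique_symmetric`**
  — MODULO `[U]` (uniqueness of the gauge-symmetric translation-invariant ground state of the pencil at every
  `μ`; a hypothesis binder, not certifiable, physically open at finite doping): every such torus limit has
  `d`-wave ODLRO `≥ (dWaveOrderParameterTT' t' U μ)²` in every box, for its supporting `μ`. The passage from
  box ODLRO of the limit STATE to the torus-diagonal pair structure factor of the summit statement (BN7) is
  NOT addressed.

`t' = 0` forms (`…_pure`) are stated with the summit's literal `hubbardTorus 2 L 1 U`.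

## References
* O. Bratteli, A. Kishimoto, D. W. Robinson, CMP 64 (1978) 41, Thm. 2 (invariant ground states =
  mean-energy minimisers). [cite: BratteliKishimotoRobinson1978, Thm. 2]
* D. Ruelle, *Statistical Mechanics: Rigorous Results* (1969), §3.4 (states of given density; supporting
  chemical potentials). [cite: Ruelle1969, §3.4]
* T. Koma, H. Tasaki, J. Stat. Phys. 76 (1994) 745–803, §1 (symmetric finite-volume ground states vs.
  symmetry breaking in infinite volume). [cite: KomaTasaki1994, §1]
-/

noncomputable section

namespace Literature.MathematicalPhysics.QuantumLattice

open _root_.Matrix Finset HubbardWave0 Literature.Probability.LatticeModels _root_.Filter Set ThermodynamicLimit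
open scoped _root_.Topology ComplexOrder

namespace InfVolFermionState

section SectorLimits

variable (t' : ℝ) {U : ℝ} {n : ℝ} {ω : InfVolFermionState 2} {ψ : ∀ L, Fock (Orb (FermionTorus 2 L))}
  {Ls : ℕ → ℕ}

/-- The particle number of a sector ground state. [cite: LiebPRL1989, proof of Theorem 1] -/
theorem IsTorusLimitOf.isNParticle_of_sectorGroundStates (t U : ℝ) {N : ℕ → ℕ}
    (hψ : ∀ j, IsGroundStateInSector (hubbardTorusTT' (Ls j) t t' U) (N j) 0 (ψ (Ls j))) (j : ℕ) :
    IsNParticle (N j) (ψ (Ls j)) :=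
  ((mem_szSector_iff _ _ _).1 (hψ j).1).1

/-- **Torus limits of sector ground states are grand-canonical ground states for a supporting chemical
potential**: `U ≥ 0`, `0 < n < 2`, unit ground states `ψ (Ls j)` of `hubbardTorusTT' (Ls j) 1 t' U` in the
sectors `(rectN n (Ls j), S^z = 0)`, `Ls → ∞` ⟹ every torus limit `ω` is a translation-invariant mean-energy
minimiser of `hubbardTTPrimeMuInteraction 1 t' U μ` for some `μ`. [cite: BratteliKishimotoRobinson1978, Thm. 2]
[cite: Ruelle1969, §3.4] -/
theorem IsTorusLimitOf.exists_isMeanEnergyMinimiser_hubbardTTPrimeMu_of_sectorGroundStates (hU : 0 ≤ U)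
    (hn0 : 0 < n) (hn2 : n < 2) (h : ω.IsTorusLimitOf ψ Ls) (hLs : Tendsto Ls atTop atTop)
    (hψ : ∀ j, IsGroundStateInSector (hubbardTorusTT' (Ls j) 1 t' U) (rectN n (Ls j)) 0 (ψ (Ls j)))
    (h1 : ∀ j, star (ψ (Ls j)) ⬝ᵥ ψ (Ls j) = 1) :
    ∃ μ : ℝ, ω.IsMeanEnergyMinimiser (hubbardTTPrimeMuInteraction 1 t' U μ) 1 := by
  have hN := IsTorusLimitOf.isNParticle_of_sectorGroundStates t' 1 U hψ
  have hρ : ω.density = n := h.density_eq_of_rectN hLs hn0.le hN h1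
  have hE := h.meanEnergy_hubbardTTPrime_eq_energyDensityTT' 1 t' hU hn0.le hn2 hLs hψ h1
  exact isMeanEnergyMinimiser_pencil_number_of_canonical (hubbardTTPrimeFermionInteraction 1 t' U) 1
    h.isTranslationInvariant hρ hn0 hn2 fun σ hσ hσn => by
      rw [hE]
      exact energyDensityTT'_le_meanEnergy_of_isTranslationInvariant 1 t' hU hn0 hn2 hσ hσn

/-- **THE LIMIT STATES OF THE SUMMIT'S GROUND STATES ARE SYMMETRIC GROUND STATES WITH ZERO PAIR AMPLITUDE.**
Under the hypotheses above every torus limit `ω` is translation invariant, GAUGE INVARIANT, of density `n`,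
vanishes on every local singlet pair `ω(P_x) = 0` (any step set and form factor), and is a mean-energy
minimiser of the grand-canonical `t–t'` pencil for some `μ`. [cite: KomaTasaki1994, §1]
[cite: BratteliKishimotoRobinson1978, Thm. 2] -/
theorem IsTorusLimitOf.symmetric_groundState_of_sectorGroundStates (hU : 0 ≤ U) (hn0 : 0 < n) (hn2 : n < 2)
    (h : ω.IsTorusLimitOf ψ Ls) (hLs : Tendsto Ls atTop atTop)
    (hψ : ∀ j, IsGroundStateInSector (hubbardTorusTT' (Ls j) 1 t' U) (rectN n (Ls j)) 0 (ψ (Ls j)))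
    (h1 : ∀ j, star (ψ (Ls j)) ⬝ᵥ ψ (Ls j) = 1) :
    ω.IsTranslationInvariant ∧ ω.IsGaugeInvariant ∧ ω.density = n ∧
      (∀ (S : Finset (Site 2)) (g : Site 2 → ℝ) (x : Site 2), ω.expect (pairRegion S x) (localPairAt S g x) = 0) ∧
      ∃ μ : ℝ, ω.IsMeanEnergyMinimiser (hubbardTTPrimeMuInteraction 1 t' U μ) 1 := by
  have hN := IsTorusLimitOf.isNParticle_of_sectorGroundStates t' 1 U hψ
  exact ⟨h.isTranslationInvariant, h.isGaugeInvariant hN, h.density_eq_of_rectN hLs hn0.le hN h1,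
    fun S g x => h.expect_localPairAt_eq_zero hN S g x,
    h.exists_isMeanEnergyMinimiser_hubbardTTPrimeMu_of_sectorGroundStates t' hU hn0 hn2 hLs hψ h1⟩

/-- **Modulo `[U]`: the limit states of the summit's ground states carry `d`-wave ODLRO `≥ (m*)²`.**
If at every chemical potential the gauge-symmetric translation-invariant ground state of
`hubbardTTPrimeMuInteraction 1 t' U μ` is unique (hypothesis `hU1`, never claimed), then every torus limit `ω`
of unit sector ground states (`U ≥ 0`, density `0 < n < 2`) satisfies, for its supporting `μ`,
`(dWaveOrderParameterTT' t' U μ)² ≤ Re N⁻⁴ Σ_{x,y∈[0,N)²} ω(P_x^d⋆ P_y^d)` for all `N ≥ 1`. (Box ODLRO of the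
LIMIT STATE; the torus-diagonal structure factor of the finite tori — the summit's object — is BN7, open.)
[cite: KomaTasaki1994, §1] -/
theorem IsTorusLimitOf.dWaveOrderParameterTT'_sq_le_re_boxAverage_of_sectorGroundStates_of_unique_symmetric
    (hU : 0 ≤ U) (hn0 : 0 < n) (hn2 : n < 2)
    (hU1 : ∀ (μ : ℝ) (ω₁ ω₂ : InfVolFermionState 2),
      ω₁.IsMeanEnergyMinimiser (hubbardTTPrimeMuInteraction 1 t' U μ) 1 → ω₁.IsGaugeInvariant →
      ω₂.IsMeanEnergyMinimiser (hubbardTTPrimeMuInteraction 1 t' U μ) 1 → ω₂.IsGaugeInvariant → ω₁ = ω₂)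
    (h : ω.IsTorusLimitOf ψ Ls) (hLs : Tendsto Ls atTop atTop)
    (hψ : ∀ j, IsGroundStateInSector (hubbardTorusTT' (Ls j) 1 t' U) (rectN n (Ls j)) 0 (ψ (Ls j)))
    (h1 : ∀ j, star (ψ (Ls j)) ⬝ᵥ ψ (Ls j) = 1) :
    ∃ μ : ℝ, ω.IsMeanEnergyMinimiser (hubbardTTPrimeMuInteraction 1 t' U μ) 1 ∧
      ∀ N : ℕ, N ≠ 0 → dWaveOrderParameterTT' t' U μ ^ 2 ≤
        (((N : ℂ) ^ 4)⁻¹ * ∑ x ∈ halfOpenBox 2 N, ∑ y ∈ halfOpenBox 2 N, ω.dWavePairCorr x y).re := by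
  have hN := IsTorusLimitOf.isNParticle_of_sectorGroundStates t' 1 U hψ
  obtain ⟨μ, hμ⟩ := h.exists_isMeanEnergyMinimiser_hubbardTTPrimeMu_of_sectorGroundStates t' hU hn0 hn2 hLs hψ h1
  exact ⟨μ, hμ, fun N hN0 =>
    hμ.dWaveOrderParameterTT'_sq_le_re_boxAverage_of_unique_symmetric t' U μ (hU1 μ) (h.isGaugeInvariant hN) hN0⟩

end SectorLimits

/-! ### `t' = 0`: the pure Hubbard tori of the summit statement -/

section Pure

variable {U : ℝ} {n : ℝ} {ω : InfVolFermionState 2} {ψ : ∀ L, Fock (Orb (FermionTorus 2 L))} {Ls : ℕ → ℕ}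

/-- **`t' = 0`, the summit's families**: torus limits of unit `(rectN n L, S^z = 0)`-sector ground states of
`hubbardTorus 2 L 1 U` (`U ≥ 0`, `0 < n < 2`; `n = 1 − δ`) are translation invariant, gauge invariant,
of density `n`, with zero pair amplitude, and mean-energy minimisers of `hubbardTTPrimeMuInteraction 1 0 U μ`
for some `μ`. [cite: KomaTasaki1994, §1] [cite: BratteliKishimotoRobinson1978, Thm. 2] -/
theorem IsTorusLimitOf.symmetric_groundState_of_sectorGroundStates_pure (hU : 0 ≤ U) (hn0 : 0 < n)
    (hn2 : n < 2) (h : ω.IsTorusLimitOf ψ Ls) (hLs : Tendsto Ls atTop atTop)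
    (hψ : ∀ j, IsGroundStateInSector (hubbardTorus 2 (Ls j) 1 U) (rectN n (Ls j)) 0 (ψ (Ls j)))
    (h1 : ∀ j, star (ψ (Ls j)) ⬝ᵥ ψ (Ls j) = 1) :
    ω.IsTranslationInvariant ∧ ω.IsGaugeInvariant ∧ ω.density = n ∧
      (∀ (S : Finset (Site 2)) (g : Site 2 → ℝ) (x : Site 2), ω.expect (pairRegion S x) (localPairAt S g x) = 0) ∧
      ∃ μ : ℝ, ω.IsMeanEnergyMinimiser (hubbardTTPrimeMuInteraction 1 0 U μ) 1 :=
  h.symmetric_groundState_of_sectorGroundStates 0 hU hn0 hn2 hLs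
    (fun j => by rw [hubbardTorusTT'_zero]; exact hψ j) h1

/-- **`t' = 0`, modulo `[U]`**: box ODLRO `≥ (dWaveOrderParameter U μ)²` of every torus limit of the
summit's sector ground states, for its supporting `μ`. [cite: KomaTasaki1994, §1] -/
theorem IsTorusLimitOf.dWaveOrderParameter_sq_le_re_boxAverage_of_sectorGroundStates_pure_of_unique_symmetric
    (hU : 0 ≤ U) (hn0 : 0 < n) (hn2 : n < 2)
    (hU1 : ∀ (μ : ℝ) (ω₁ ω₂ : InfVolFermionState 2),
      ω₁.IsMeanEnergyMinimiser (hubbardTTPrimeMuInteraction 1 0 U μ) 1 → ω₁.IsGaugeInvariant →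
      ω₂.IsMeanEnergyMinimiser (hubbardTTPrimeMuInteraction 1 0 U μ) 1 → ω₂.IsGaugeInvariant → ω₁ = ω₂)
    (h : ω.IsTorusLimitOf ψ Ls) (hLs : Tendsto Ls atTop atTop)
    (hψ : ∀ j, IsGroundStateInSector (hubbardTorus 2 (Ls j) 1 U) (rectN n (Ls j)) 0 (ψ (Ls j)))
    (h1 : ∀ j, star (ψ (Ls j)) ⬝ᵥ ψ (Ls j) = 1) :
    ∃ μ : ℝ, ω.IsMeanEnergyMinimiser (hubbardTTPrimeMuInteraction 1 0 U μ) 1 ∧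
      ∀ N : ℕ, N ≠ 0 → dWaveOrderParameter U μ ^ 2 ≤
        (((N : ℂ) ^ 4)⁻¹ * ∑ x ∈ halfOpenBox 2 N, ∑ y ∈ halfOpenBox 2 N, ω.dWavePairCorr x y).re := by
  have h' := h.dWaveOrderParameterTT'_sq_le_re_boxAverage_of_sectorGroundStates_of_unique_symmetric 0 hU hn0 hn2
    hU1 hLs (fun j => by rw [hubbardTorusTT'_zero]; exact hψ j) h1
  simpa only [dWaveOrderParameterTT'_zero] using h'

end Pure

end InfVolFermionState

end Literature.MathematicalPhysics.QuantumLattice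

end
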